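import Mathlib
import Summits.ValiantsHypothesis.ValiantsHypothesis.Theses.FreeSubtorus
import Summits.ValiantsHypothesis.ValiantsHypothesis.Theorems.FreeSubtorusSubtorusCovering
import Summits.ValiantsHypothesis.ValiantsHypothesis.Cruxes.OrbitDimensionBound.Lines.DegreeLadder
import Literature.Computability.AlgebraicComplexity.HomogeneousComponentsComplexity
import Literature.Computability.AlgebraicComplexity.IMMInVPProofs
import Literature.Computability.AlgebraicComplexity.ArithCircuitProofs
import Literature.Computability.AlgebraicComplexity.HamiltonianCycleVNP
import Literature.Computability.AlgebraicComplexity.EquivariantDC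
import Literature.Computability.AlgebraicComplexity.DetInVP
import Literature.RingTheory.MvPolynomial.IteratedDerivations

/-!
# `PowerLadder` — forward rung g8 on the crux `FreeSubtorus.OrbitDimensionBound`

FORWARD GENERATOR G1 (next-rung), unit `fwd2-rung-ValiantsHypothesis-01-g8`.

* FLOOR (proved, `Theorems/FreeSubtorusSubtorusCovering.lean`, `subtorusCovering_proof`):
  `SubtorusCovering` — for `n ≥ 3`, every exactly `T_Λ`-equivariant affine determinantal representation `B` of
  `per_n` of size `m`, `Λ` admissible with `r` generators, has `C(n, ⌊n/2⌋) ≤ m · 2^r`.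
* THE DIAL `k` = the MULTIPLICITY of the permanent: the represented polynomial is `per_n ^ k` instead of `per_n`
  (same variables, same torus `T_Λ`, same affine entries, same exact constant lifts — `IsEquivariantDetRepr` of the
  tree ON THE NOSE, applied to `perPoly (Fin n) ℂ ^ k`).  `k = 1` is the floor (`powerCovering_one_iff`, by
  `pow_one`/`one_mul`), `k = 0` is false (the empty matrix represents `1 = per_n ^ 0`, `not_powerCovering_zero`).
* NUMERIC FAMILY `PowerCovering k`: a `T_Λ`-equivariant affine representation of `per_n ^ k` of size `m`
  (`Λ` admissible, `r` generators) has `C(n, ⌊n/2⌋) ≤ k · m · 2^r` — "a representation of the `k`-th power is at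
  least `1/k` times as large as one of `per_n` itself".  RUNG (numeric): `SquareCovering := PowerCovering 2`.
  WHY IT IS NOT A COROLLARY OF THE FLOOR: `per_n ^ k` is not a projection of `per_n` and a representation of
  `per_n ^ k` does not restrict to one of `per_n`; the floor's proof breaks at two located points — (i) von zur
  Gathen regularity (`vonzurGathen1987_perm_detRepr_rank`: corank of the constant part `≤ 1`, from
  `codim Sing Z(per_n) ≥ 2`) FAILS for `per_n ^ k`, whose hypersurface `Z(per_n ^ k) = Z(per_n)` is singular
  everywhere as a scheme (`diag(A, A)` has corank `2`); (ii) the level count `torusBound_levelCount` (unique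
  factorisation of the squarefree monomials `x_σ`) breaks: restricted to the graph of `σ` the pencil has determinant
  `x_σ ^ k`, and chains pass through exponent vectors in `{0,…,k}^n` whose flat members have `σ`-independent weight.
  Determinantal representations of `f ^ k` are (after homogenisation) matrix factorisations of the hypersurface
  `f` of higher rank [cite: Eisenbud1980, §5–6]; indecomposable ones smaller than `k · dc(f)` exist in general, which
  is why the factor `k` is a genuine bet (skeleton `Lines/square_covering.lean`: Krull–Schmidt reduction to
  indecomposable `T_Λ°`-equivariant summands + a Fitting-lemma substitute for regularity).
* SHADOW (the filed rung declaration, asymptotic, implied by the Statement BY NAME): `PowerShadow k` — along any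
  sequence of admissible `Λ_n` and `T_{Λ_n}`-equivariant affine representations `B_n` of `per_n ^ k` of size `m_n`,
  `n ↦ m_n · 2^{r_n}` is not p-bounded (the floor's own gauge: `powerShadow_one_iff`).
  `SquareShadow := PowerShadow 2`; `squareShadow_of_summit : ValiantsHypothesis → SquareShadow` is PROVED here
  (`aesop` safe rule) through a **Kaltofen-free `k`-th root extraction for circuit complexity** (§3,
  `complexity_le_of_pow`): if `deg g ≤ N` and `g(a) ≠ 0` then `L(g) ≤ O(N⁴) · (L(g^k) + #vars)`, by shifting `a`
  to the origin, taking the truncated binomial series `(1+v)^{1/k}` (`PowerSeries.binomialSeries ℂ k⁻¹`) of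
  `v = c^{-k} g̃^k − 1`, identifying it with `c^{-1} g̃` modulo `𝔪^{N+1}` (uniqueness of `k`-th roots `≡ 1`
  modulo nilpotents in `ℂ[x]/𝔪^{N+1}`) and cutting above degree `N` with ONE homogeneous-component pass
  (`complexity_sum_homogeneousComponent_le`).  For `per_n`: `a = 𝟙`, `per_n(𝟙) = n! ≠ 0`, `N = n`; so a p-bounded
  sequence of representations of `per_n ^ k` makes `PER` p-computable, i.e. `VP_ℂ = VNP_ℂ`
  (`isPComputable_perPoly_complex_iff`).  (The g6 seat set the powers dial aside as "on-path needs VP root-closure,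
  absent from the tree" — §3 supplies exactly that closure.)
* §4 records how the rung relaxes the open crux: `OrbitPowerBound k` (eventually in `n`, symmetrise INTO an
  equivariant representation of SOME power `per_n ^ j`, `1 ≤ j ≤ k`, of size `≤ k·m`, budget `r ≤ ⌊n/2⌋`; implied
  by the crux with `j = 1`), `closes_square : OrbitPowerBound 2 → SquareCovering → VH` (constant loss `4 ≤ n`,
  absorbed by the exponential-`dc` glue `vh_of_eventual_linear_loss`) and `closes_of_orbitDimensionBound`.

Informal sources of the dial: Landsberg–Ressayre pose `edc` for the permanent itself
[cite: LandsbergRessayre2017, Question 2.2, Def. 1.3]; closure of `VP` under factors (hence roots) is Kaltofen's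
theorem [cite: Burgisser2000, Thm. 2.21 (Kaltofen)], replaced here by the elementary truncated-binomial-series
extraction for polynomials with a non-vanishing point; determinantal representations of powers `f^k` as matrix
factorisations [cite: Eisenbud1980, Thm. 6.1].  Everything in this file is PROVED (no `sorry`); the numeric rung
for `k = 2` is the content of the registered skeleton `Lines/square_covering.lean`.
-/

open Matrix MvPolynomial Finset
open Literature.Computability.AlgebraicComplexity
open Summit.ValiantsHypothesis.ValiantsHypothesis.Cruxes.OrbitDimensionBound.Degree

-- the mandated summit-side namespace repeats a component by design (single-problem summit)
set_option linter.dupNamespace false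

namespace Summit.ValiantsHypothesis.ValiantsHypothesis.Cruxes.OrbitDimensionBound.Power

noncomputable section

/-! ## §1 The numeric family `PowerCovering k` over the floor -/

/-- **`PowerCovering k`** (numeric family, graded by the multiplicity `k`): for `n ≥ 3`, a `T_Λ`-equivariant
(exact constant lifts) AFFINE determinantal representation `B` of `per_n ^ k` of size `m`, `Λ` admissible with `r`
generators, has `C(n, ⌊n/2⌋) ≤ k · (m · 2^r)`.  `k = 1` is the floor (`powerCovering_one_iff`).
[cite: LandsbergRessayre2017, Thm. 2.8, §6] [cite: Eisenbud1980, Thm. 6.1] -/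
def PowerCovering (k : ℕ) : Prop :=
  ∀ n : ℕ, 3 ≤ n → ∀ (m r : ℕ) (Λ : Fin r → (Fin n ⊕ Fin n) → ℤ)
    (B : Matrix (Fin m) (Fin m) (MvPolynomial (Fin n × Fin n) ℂ)),
    Admissible n r Λ →
    IsEquivariantDetRepr (Subgroup.closure (torusGen n r Λ)) (perPoly (Fin n) ℂ ^ k) B →
    Nat.choose n (n / 2) ≤ k * (m * 2 ^ r)

/-- **RUNG (numeric) `SquareCovering`** := `PowerCovering 2`: equivariant affine representations of the SQUARE
of the permanent obey the covering bound with loss `2`. [cite: LandsbergRessayre2017, §6] -/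
def SquareCovering : Prop := PowerCovering 2

/-- **The floor is the `k = 1` member** (`per_n ^ 1 = per_n`, `1 · x = x`). [cite: LandsbergRessayre2017, Thm. 2.8] -/
theorem powerCovering_one_iff :
    PowerCovering 1 ↔ Summit.ValiantsHypothesis.ValiantsHypothesis.Theses.FreeSubtorus.SubtorusCovering := by
  simp only [PowerCovering, pow_one, one_mul]
  exact Iff.rfl

/-- Hence `PowerCovering 1` is a theorem (the floor, `subtorusCovering_proof`). [cite: LandsbergRessayre2017, Thm. 2.8] -/
theorem powerCovering_one : PowerCovering 1 :=
  powerCovering_one_iff.mpr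
    Summit.ValiantsHypothesis.ValiantsHypothesis.Theorems.FreeSubtorusSubtorusCovering.subtorusCovering_proof

/-- The empty matrix is an equivariant affine representation of `1 = f ^ 0` for any symmetry group. [folklore] -/
theorem isEquivariantDetRepr_pow_zero {n : ℕ} (Γ : Subgroup (GL (Fin n × Fin n) ℂ))
    (f : MvPolynomial (Fin n × Fin n) ℂ) :
    IsEquivariantDetRepr Γ (f ^ 0) (fun _ _ => 0 : Matrix (Fin 0) (Fin 0) (MvPolynomial (Fin n × Fin n) ℂ)) := by
  refine ⟨⟨fun i => Fin.elim0 i, by rw [pow_zero, Matrix.det_isEmpty]⟩, fun γ _ => ⟨1, 1, ?_⟩⟩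
  ext i
  exact Fin.elim0 i

/-- The `k = 0` member is FALSE (`C(3,1) = 3 > 0`): the dial starts at the floor. [folklore] -/
theorem not_powerCovering_zero : ¬ PowerCovering 0 := by
  intro h
  have hΛ : Admissible 3 0 (fun i => Fin.elim0 i) := fun i => Fin.elim0 i
  have := h 3 le_rfl 0 0 (fun i => Fin.elim0 i) (fun _ _ => 0) hΛ (isEquivariantDetRepr_pow_zero _ _)
  norm_num [Nat.choose] at this

/-- A representation of `per_n ^ k` (`n, k ≥ 1`) has size `m ≥ 1`. [folklore] -/
theorem one_le_size_pow {n m k : ℕ} (hn : 1 ≤ n) (hk : 1 ≤ k) {Γ : Subgroup (GL (Fin n × Fin n) ℂ)}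
    {B : Matrix (Fin m) (Fin m) (MvPolynomial (Fin n × Fin n) ℂ)}
    (hB : IsEquivariantDetRepr Γ (perPoly (Fin n) ℂ ^ k) B) : 1 ≤ m := by
  rcases Nat.eq_zero_or_pos m with h0 | h0
  · subst h0
    exfalso
    have h3 : B.det = 1 := Matrix.det_isEmpty
    have h4 := congrArg constantCoeff hB.1.2
    rw [h3, map_pow, constantCoeff_perPoly ℂ hn, map_one, zero_pow (by omega)] at h4
    exact one_ne_zero h4
  · exact h0

/-! ## §2 The shadow `PowerShadow k` (filed rung declaration = `SquareShadow`) -/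

/-- **`PowerShadow k`** (asymptotic shadow of `PowerCovering k`, in the floor's gauge): along any sequence of
admissible `Λ_n` and `T_{Λ_n}`-equivariant affine determinantal representations `B_n` of `per_n ^ k` of sizes
`m_n` (`n ≥ 3`), the function `n ↦ m_n · 2^{r_n}` is not p-bounded. [cite: LandsbergRessayre2017, Question 2.2]
[cite: Burgisser2000, Def. 2.1] -/
def PowerShadow (k : ℕ) : Prop :=
  ∀ (m r : ℕ → ℕ) (Λ : (n : ℕ) → Fin (r n) → (Fin n ⊕ Fin n) → ℤ)
    (B : (n : ℕ) → Matrix (Fin (m n)) (Fin (m n)) (MvPolynomial (Fin n × Fin n) ℂ)),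
    (∀ n : ℕ, 3 ≤ n → Admissible n (r n) (Λ n) ∧
      IsEquivariantDetRepr (Subgroup.closure (torusGen n (r n) (Λ n))) (perPoly (Fin n) ℂ ^ k) (B n)) →
    ¬ IsPBounded (fun n => m n * 2 ^ (r n))

/-- **RUNG DECLARATION `SquareShadow`** := `PowerShadow 2`. [cite: LandsbergRessayre2017, Question 2.2] -/
def SquareShadow : Prop := PowerShadow 2

/-- The `k = 0` shadow is FALSE (the empty representations of `1` have `m_n · 2^0 = 0`). [folklore] -/
theorem not_powerShadow_zero : ¬ PowerShadow 0 := by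
  intro h
  refine h (fun _ => 0) (fun _ => 0) (fun n i => Fin.elim0 i) (fun n => fun _ _ => 0)
    (fun n _ => ⟨fun i => Fin.elim0 i, isEquivariantDetRepr_pow_zero _ _⟩) ?_
  simpa using IsPBounded.const 0

/-- **Numeric rung ⇒ shadow**: `C(n, ⌊n/2⌋) ≤ k · m_n 2^{r_n}` and the middle binomial is not p-bounded
(for `k = 0` the premise is false anyway). [folklore] -/
theorem powerShadow_of_powerCovering {k : ℕ} (h : PowerCovering k) : PowerShadow k := by
  intro m r Λ B hyp hPB
  have hk' : IsPBounded (fun n => k * (m n * 2 ^ (r n))) := IsPBounded.mul_holds (IsPBounded.const k) hPB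
  refine not_isPBounded_choose_window (δ := 1) le_rfl (IsPBounded.of_eventually_le 3 hk' fun n hn => ?_)
  have e : n / 2 + 1 - 1 = n / 2 := by omega
  rw [e]
  exact h n hn (m n) (r n) (Λ n) (B n) (hyp n hn).1 (hyp n hn).2

/-- The floor's shadow in this gauge, unconditionally (from the proved floor). [cite: LandsbergRessayre2017, Thm. 2.8] -/
theorem powerShadow_one : PowerShadow 1 := powerShadow_of_powerCovering powerCovering_one

/-- **At `k = 1` the shadow IS the floor's shadow** `CoveringShadow powLoss` of `ConfusionLadder` (same gauge).
[folklore] -/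
theorem powerShadow_one_iff : PowerShadow 1 ↔ Confusion.CoveringShadow Confusion.powLoss := by
  simp only [PowerShadow, pow_one, Confusion.CoveringShadow, Confusion.powLoss, Admissible, torusGen]

/-! ## §3 Kaltofen-free `k`-th root extraction and the on-path lemma `S → PowerShadow k` -/

/-! ### The truncated binomial series `(1+X)^{1/k} mod X^{N+1}` -/

/-- `rootPoly k N = Σ_{i ≤ N} binom(1/k, i) X^i`. [folklore] -/
def rootPoly (k N : ℕ) : Polynomial ℂ :=
  PowerSeries.trunc (N + 1) (PowerSeries.binomialSeries ℂ ((k : ℂ)⁻¹))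

theorem natDegree_rootPoly_lt (k N : ℕ) : (rootPoly k N).natDegree < N + 1 :=
  PowerSeries.natDegree_trunc_lt _ _

theorem rootPoly_coeff_zero (k N : ℕ) : (rootPoly k N).coeff 0 = 1 := by
  simp [rootPoly, PowerSeries.coeff_trunc]

theorem binomialSeries_natMul (r : ℂ) :
    ∀ j : ℕ, PowerSeries.binomialSeries ℂ ((j : ℂ) * r) = (PowerSeries.binomialSeries ℂ r) ^ j := by
  intro j
  induction j with
  | zero => simp
  | succ j ih => rw [Nat.cast_succ, add_mul, one_mul, PowerSeries.binomialSeries_add, ih, pow_succ]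

/-- `(rootPoly k N)^k ≡ 1 + X (mod X^{N+1})` for `k ≥ 1`. [folklore] -/
theorem X_pow_dvd_rootPoly_pow_sub {k : ℕ} (hk : 1 ≤ k) (N : ℕ) :
    (Polynomial.X : Polynomial ℂ) ^ (N + 1) ∣ (rootPoly k N) ^ k - (1 + Polynomial.X) := by
  rw [Polynomial.X_pow_dvd_iff]
  intro d hd
  have hk0 : (k : ℂ) ≠ 0 := by exact_mod_cast (show k ≠ 0 by omega)
  have hone : (PowerSeries.binomialSeries ℂ ((k : ℂ)⁻¹)) ^ k = 1 + PowerSeries.X := by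
    rw [← binomialSeries_natMul ((k : ℂ)⁻¹) k, mul_inv_cancel₀ hk0]
    have h := PowerSeries.binomialSeries_nat (R := ℂ) (A := ℂ) 1
    rw [Nat.cast_one, pow_one] at h
    exact h
  have h1 : ((rootPoly k N) ^ k).coeff d =
      PowerSeries.coeff d ((PowerSeries.binomialSeries ℂ ((k : ℂ)⁻¹)) ^ k) := by
    have h2 := congrArg (fun p : Polynomial ℂ => p.coeff d)
      (PowerSeries.trunc_trunc_pow (PowerSeries.binomialSeries ℂ ((k : ℂ)⁻¹)) (N + 1) k)
    simp only [PowerSeries.coeff_trunc, if_pos hd] at h2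
    rw [← h2, ← Polynomial.coeff_coe, Polynomial.coe_pow]
    rfl
  rw [Polynomial.coeff_sub, h1, hone, map_add, PowerSeries.coeff_one, PowerSeries.coeff_X,
    Polynomial.coeff_add, Polynomial.coeff_one, Polynomial.coeff_X]
  by_cases h0 : d = 0
  · subst h0; simp
  · by_cases h1' : d = 1
    · subst h1'; simp
    · simp [h0, h1', Ne.symm h1']

/-! ### Membership in powers of the irrelevant ideal `𝔪 = (X_i)_i` -/

variable {σ : Type*}

theorem mem_idealOfVars_of_constantCoeff {p : MvPolynomial σ ℂ} (h : constantCoeff p = 0) :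
    p ∈ idealOfVars σ ℂ := by
  rw [← pow_one (idealOfVars σ ℂ), mem_pow_idealOfVars_iff']
  intro x hx
  have hx0 : x = 0 := (Finsupp.degree_eq_zero_iff x).1 (by omega)
  subst hx0
  simpa [constantCoeff_eq] using h

/-- Evaluating a polynomial divisible by `X^n` at `v ∈ 𝔪` lands in `𝔪^n`. [folklore] -/
theorem aeval_mem_pow_of_X_pow_dvd {v : MvPolynomial σ ℂ} (hv : v ∈ idealOfVars σ ℂ) {n : ℕ}
    {D : Polynomial ℂ} (hD : (Polynomial.X : Polynomial ℂ) ^ n ∣ D) :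
    Polynomial.aeval v D ∈ idealOfVars σ ℂ ^ n := by
  obtain ⟨R, hR⟩ := hD
  rw [hR, map_mul, map_pow, Polynomial.aeval_X]
  exact Ideal.mul_mem_right _ _ (Ideal.pow_mem_pow hv n)

/-! ### Uniqueness of `k`-th roots `≡ 1` modulo nilpotents -/

theorem eq_of_pow_eq_of_isNilpotent {Q : Type*} [CommRing Q] [Algebra ℂ Q] {k : ℕ} (hk : 1 ≤ k)
    {a b : Q} (hab : a ^ k = b ^ k) (ha : IsNilpotent (a - 1)) (hb : IsNilpotent (b - 1)) : a = b := by
  have hk0 : (k : ℂ) ≠ 0 := by exact_mod_cast (show k ≠ 0 by omega)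
  -- powers minus one are nilpotent
  have hapow : ∀ i : ℕ, IsNilpotent (a ^ i - 1) := fun i => by
    rw [← geom_sum_mul a i]
    exact Commute.isNilpotent_mul_left (Commute.all _ _) ha
  have hbpow : ∀ i : ℕ, IsNilpotent (b ^ i - 1) := fun i => by
    rw [← geom_sum_mul b i]
    exact Commute.isNilpotent_mul_left (Commute.all _ _) hb
  set S : Q := ∑ i ∈ range k, a ^ i * b ^ (k - 1 - i) with hS_def
  have hSnil : IsNilpotent (S - (k : Q)) := by
    have hk' : (k : Q) = ∑ _i ∈ range k, (1 : Q) := by simp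
    rw [hk', hS_def, ← Finset.sum_sub_distrib]
    refine isNilpotent_sum fun i _ => ?_
    have e : a ^ i * b ^ (k - 1 - i) - 1 = (a ^ i - 1) * b ^ (k - 1 - i) + (b ^ (k - 1 - i) - 1) := by ring
    rw [e]
    exact Commute.isNilpotent_add (Commute.all _ _)
      (Commute.isNilpotent_mul_right (Commute.all _ _) (hapow i)) (hbpow _)
  have hkU : IsUnit (k : Q) := by
    have h := (isUnit_iff_ne_zero.mpr hk0).map (algebraMap ℂ Q)
    rwa [map_natCast] at h
  have hSU : IsUnit S := by
    have h := IsNilpotent.isUnit_add_right_of_commute hSnil hkU (Commute.all _ _)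
    rwa [sub_add_cancel] at h
  have h0 : S * (a - b) = 0 := by
    rw [hS_def, geom_sum₂_mul, hab, sub_self]
  exact sub_eq_zero.1 ((hSU.mul_right_eq_zero).1 h0)

/-! ### The main congruence -/

/-- If `constantCoeff u = 1`, `v = u^k - 1` and `A = rootPoly(v)`, then `A ≡ u (mod 𝔪^{N+1})`. [folklore] -/
theorem rootPoly_aeval_sub_mem {k : ℕ} (hk : 1 ≤ k) (N : ℕ) (u : MvPolynomial σ ℂ)
    (hu : constantCoeff u = 1) :
    Polynomial.aeval (u ^ k - 1) (rootPoly k N) - u ∈ idealOfVars σ ℂ ^ (N + 1) := by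
  set v : MvPolynomial σ ℂ := u ^ k - 1 with hv_def
  set A : MvPolynomial σ ℂ := Polynomial.aeval v (rootPoly k N) with hA_def
  set I : Ideal (MvPolynomial σ ℂ) := idealOfVars σ ℂ ^ (N + 1) with hI_def
  have hv : v ∈ idealOfVars σ ℂ := mem_idealOfVars_of_constantCoeff (by simp [hv_def, hu])
  have hu1 : u - 1 ∈ idealOfVars σ ℂ := mem_idealOfVars_of_constantCoeff (by simp [hu])
  -- `A - 1 ∈ 𝔪`
  have hA1 : A - 1 ∈ idealOfVars σ ℂ := by
    have hdvd : (Polynomial.X : Polynomial ℂ) ^ 1 ∣ rootPoly k N - 1 := by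
      rw [pow_one, Polynomial.X_dvd_iff, Polynomial.coeff_sub, rootPoly_coeff_zero, Polynomial.coeff_one_zero,
        sub_self]
    have h := aeval_mem_pow_of_X_pow_dvd hv hdvd
    rwa [pow_one, map_sub, map_one] at h
  -- `A^k - u^k ∈ 𝔪^{N+1}`
  have hAk : A ^ k - u ^ k ∈ I := by
    have h := aeval_mem_pow_of_X_pow_dvd hv (X_pow_dvd_rootPoly_pow_sub hk N)
    rw [map_sub, map_pow, map_add, map_one, Polynomial.aeval_X] at h
    have e : A ^ k - u ^ k = A ^ k - (1 + v) := by rw [hv_def]; ring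
    rwa [e]
  -- pass to the quotient
  have key : Ideal.Quotient.mk I A = Ideal.Quotient.mk I u := by
    apply eq_of_pow_eq_of_isNilpotent (Q := MvPolynomial σ ℂ ⧸ I) hk
    · have h := (Ideal.Quotient.eq (I := I)).2 hAk
      simpa only [map_pow] using h
    · refine ⟨N + 1, ?_⟩
      rw [← map_one (Ideal.Quotient.mk I), ← map_sub, ← map_pow, Ideal.Quotient.eq_zero_iff_mem]
      exact Ideal.pow_mem_pow hA1 _
    · refine ⟨N + 1, ?_⟩
      rw [← map_one (Ideal.Quotient.mk I), ← map_sub, ← map_pow, Ideal.Quotient.eq_zero_iff_mem]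
      exact Ideal.pow_mem_pow hu1 _
  exact Ideal.Quotient.eq.1 key

/-! ### Cutting above degree `N` -/

theorem sum_homogeneousComponent_of_le {N : ℕ} (p : MvPolynomial σ ℂ) (hp : p.totalDegree ≤ N) :
    ∑ d ∈ range (N + 1), homogeneousComponent d p = p := by
  classical
  ext x
  rw [coeff_sum]
  simp only [coeff_homogeneousComponent]
  rw [Finset.sum_ite_eq]
  split_ifs with hmem
  · rfl
  · rw [Finset.mem_range, not_lt] at hmem
    symm
    apply coeff_eq_zero_of_totalDegree_lt
    have : Finsupp.degree x = ∑ i ∈ x.support, x i := rfl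
    omega

theorem sum_homogeneousComponent_congr {N : ℕ} {A u : MvPolynomial σ ℂ} (h : A - u ∈ idealOfVars σ ℂ ^ (N + 1)) :
    ∑ d ∈ range (N + 1), homogeneousComponent d A = ∑ d ∈ range (N + 1), homogeneousComponent d u := by
  classical
  rw [mem_pow_idealOfVars_iff'] at h
  refine Finset.sum_congr rfl fun d hd => ?_
  rw [Finset.mem_range] at hd
  ext x
  rw [coeff_homogeneousComponent, coeff_homogeneousComponent]
  split_ifs with hx
  · have h' := h x (by omega)
    rwa [coeff_sub, sub_eq_zero] at h'
  · rfl

/-! ### Complexity bookkeeping -/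

theorem complexity_pow_le' (f : MvPolynomial σ ℂ) : ∀ j : ℕ, complexity (f ^ j) ≤ j * (complexity f + 1) := by
  intro j
  induction j with
  | zero =>
    rw [pow_zero, ← C_1, complexity_C_holds]
    exact Nat.zero_le _
  | succ j ih =>
    rw [pow_succ]
    calc complexity (f ^ j * f) ≤ complexity (f ^ j) + complexity f + 1 := complexity_mul_le_holds _ _
      _ ≤ j * (complexity f + 1) + complexity f + 1 := by omega
      _ = (j + 1) * (complexity f + 1) := by ring

theorem complexity_polynomial_aeval_le {p : Polynomial ℂ} {n : ℕ} (hp : p.natDegree < n) (v : MvPolynomial σ ℂ) :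
    complexity (Polynomial.aeval v p) ≤ n * (n * (complexity v + 1) + 1) + n := by
  rw [Polynomial.aeval_eq_sum_range' hp]
  have h := complexity_sum_le_of_le (range n) (fun i => p.coeff i • v ^ i) (n * (complexity v + 1) + 1)
    (fun i hi => by
      rw [Finset.mem_range] at hi
      calc complexity (p.coeff i • v ^ i) ≤ complexity (v ^ i) + 1 := complexity_smul_le_holds _ _
        _ ≤ i * (complexity v + 1) + 1 := by have := complexity_pow_le' v i; omega
        _ ≤ n * (complexity v + 1) + 1 := by gcongr)
  simpa [Finset.card_range] using h

theorem complexity_X_add_C_le (i : σ) (c : ℂ) : complexity (X i + C c : MvPolynomial σ ℂ) ≤ 1 := by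
  calc complexity (X i + C c : MvPolynomial σ ℂ) ≤ complexity (X i : MvPolynomial σ ℂ) + complexity (C c : MvPolynomial σ ℂ) + 1 :=
        complexity_add_le_holds _ _
    _ = 1 := by rw [complexity_X_holds, complexity_C_holds]

theorem complexity_sub_C_le (f : MvPolynomial σ ℂ) (c : ℂ) : complexity (f - C c) ≤ complexity f + 1 := by
  rw [sub_eq_add_neg, ← C_neg]
  calc complexity (f + C (-c)) ≤ complexity f + complexity (C (-c) : MvPolynomial σ ℂ) + 1 := complexity_add_le_holds _ _
    _ = complexity f + 1 := by rw [complexity_C_holds]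

/-! ### The root-extraction theorem -/

variable [Fintype σ]

/-- **`k`-th root extraction for circuit complexity (Kaltofen-free).**  If `deg g ≤ N`, `g(a) ≠ 0` and `k ≥ 1`
then `L(g) ≤ (N+2)² · ((N+1)((N+1)(L(g^k) + |σ| + 3) + 1) + (N+1)) + N + 2 + |σ|`. [folklore] -/
theorem complexity_le_of_pow (g : MvPolynomial σ ℂ) (a : σ → ℂ) (ha : eval a g ≠ 0) {N : ℕ}
    (hN : g.totalDegree ≤ N) {k : ℕ} (hk : 1 ≤ k) :
    complexity g ≤ (N + 2) ^ 2 * ((N + 1) * ((N + 1) * (complexity (g ^ k) + Fintype.card σ + 3) + 1) + (N + 1))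
      + (N + 1) + 1 + Fintype.card σ := by
  -- the shift
  set sh : σ → MvPolynomial σ ℂ := fun i => X i + C (a i) with hsh_def
  set ush : σ → MvPolynomial σ ℂ := fun i => X i - C (a i) with hush_def
  set c : ℂ := eval a g with hc_def
  set gt : MvPolynomial σ ℂ := aeval sh g with hgt_def
  have hgt0 : constantCoeff gt = c := by
    have h1 : aeval (0 : σ → ℂ) gt = aeval (fun i => aeval (0 : σ → ℂ) (sh i)) g :=
      comp_aeval_apply sh (aeval (0 : σ → ℂ)) g
    have h2 : (fun i => aeval (0 : σ → ℂ) (sh i)) = a := by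
      funext i; simp [hsh_def]
    rw [h2] at h1
    rw [← eval_zero]
    exact h1
  have hunshift : aeval ush gt = g := by
    rw [hgt_def, comp_aeval_apply]
    have : (fun i => aeval ush (sh i)) = X := by
      funext i; simp [hsh_def, hush_def]
    rw [this, aeval_X_left, AlgHom.id_apply]
  -- normalise the constant term
  set u : MvPolynomial σ ℂ := c⁻¹ • gt with hu_def
  have hu1 : constantCoeff u = 1 := by
    rw [hu_def, constantCoeff_smul, hgt0, smul_eq_mul, inv_mul_cancel₀ ha]
  have hudeg : u.totalDegree ≤ N := by
    calc u.totalDegree ≤ gt.totalDegree := totalDegree_smul_le _ _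
      _ ≤ g.totalDegree := Literature.RingTheory.MvPolynomial.totalDegree_aeval_le_of_le_one sh
          (fun i => (totalDegree_add _ _).trans (by rw [totalDegree_X, totalDegree_C]; simp)) g
      _ ≤ N := hN
  -- the candidate root and its degree-`≤ N` part
  set v : MvPolynomial σ ℂ := u ^ k - 1 with hv_def
  set A : MvPolynomial σ ℂ := Polynomial.aeval v (rootPoly k N) with hA_def
  set P : MvPolynomial σ ℂ := ∑ d ∈ range (N + 1), homogeneousComponent d A with hP_def
  have hPu : P = u := by
    rw [hP_def, sum_homogeneousComponent_congr (rootPoly_aeval_sub_mem hk N u hu1),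
      sum_homogeneousComponent_of_le u hudeg]
  have hv_eq : v = (c⁻¹) ^ k • aeval sh (g ^ k) - 1 := by
    rw [hv_def, hu_def, smul_pow, map_pow]
  have hg_eq : aeval ush (c • P) = g := by
    rw [hPu, hu_def, smul_smul, mul_inv_cancel₀ ha, one_smul, hunshift]
  -- complexity bookkeeping
  have hsh_sum : ∑ i, complexity (sh i) ≤ Fintype.card σ := by
    calc ∑ i, complexity (sh i) ≤ ∑ _i : σ, 1 := Finset.sum_le_sum fun i _ => complexity_X_add_C_le i (a i)
      _ = Fintype.card σ := by simp
  have hush_sum : ∑ i, complexity (ush i) ≤ Fintype.card σ := by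
    calc ∑ i, complexity (ush i) ≤ ∑ _i : σ, 1 := Finset.sum_le_sum fun i _ => by
            have h := complexity_sub_C_le (X i : MvPolynomial σ ℂ) (a i)
            rw [complexity_X_holds] at h
            simpa [hush_def] using h
      _ = Fintype.card σ := by simp
  have hLsh : complexity (aeval sh (g ^ k)) ≤ complexity (g ^ k) + Fintype.card σ :=
    (complexity_aeval_le _ _).trans (by omega)
  have hLv : complexity v ≤ complexity (g ^ k) + Fintype.card σ + 2 := by
    rw [hv_eq]
    have h1 : complexity ((c⁻¹) ^ k • aeval sh (g ^ k) - 1) ≤ complexity ((c⁻¹) ^ k • aeval sh (g ^ k)) + 1 := by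
      have h := complexity_sub_C_le ((c⁻¹) ^ k • aeval sh (g ^ k)) 1
      rwa [C_1] at h
    have h2 : complexity ((c⁻¹) ^ k • aeval sh (g ^ k)) ≤ complexity (aeval sh (g ^ k)) + 1 :=
      complexity_smul_le_holds _ _
    omega
  set W : ℕ := complexity v + 1 with hW_def
  have hW : W ≤ complexity (g ^ k) + Fintype.card σ + 3 := by omega
  have hLA : complexity A ≤ (N + 1) * ((N + 1) * W + 1) + (N + 1) :=
    complexity_polynomial_aeval_le (natDegree_rootPoly_lt k N) v
  have hLP : complexity P ≤ (N + 2) ^ 2 * complexity A + (N + 1) := complexity_sum_homogeneousComponent_le A N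
  have hLcP : complexity (c • P) ≤ complexity P + 1 := complexity_smul_le_holds _ _
  have hLg : complexity g ≤ complexity (c • P) + Fintype.card σ := by
    conv_lhs => rw [← hg_eq]
    exact (complexity_aeval_le _ _).trans (by omega)
  set LA : ℕ := complexity A with hLA_def
  calc complexity g ≤ complexity P + 1 + Fintype.card σ := by omega
    _ ≤ (N + 2) ^ 2 * LA + (N + 1) + 1 + Fintype.card σ := by omega
    _ ≤ (N + 2) ^ 2 * ((N + 1) * ((N + 1) * W + 1) + (N + 1)) + (N + 1) + 1 + Fintype.card σ := by gcongr
    _ ≤ (N + 2) ^ 2 * ((N + 1) * ((N + 1) * (complexity (g ^ k) + Fintype.card σ + 3) + 1) + (N + 1))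
          + (N + 1) + 1 + Fintype.card σ := by gcongr


/-! ### Application to the permanent -/

/-- `per_n(𝟙) = n!`. [folklore] -/
theorem eval_one_perPoly (n : ℕ) : eval (fun _ => (1 : ℂ)) (perPoly (Fin n) ℂ) = (n.factorial : ℂ) := by
  rw [eval_perPoly]
  simp [Matrix.permanent, Fintype.card_perm]

/-- Root extraction for the permanent: `L(per_n) ≤ O(n⁴) · (L(per_n ^ k) + n²)` for `k ≥ 1`. [folklore] -/
theorem complexity_perPoly_le_of_pow (n k : ℕ) (hk : 1 ≤ k) :
    complexity (perPoly (Fin n) ℂ) ≤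
      (n + 2) ^ 2 * ((n + 1) * ((n + 1) * (complexity (perPoly (Fin n) ℂ ^ k) + n * n + 3) + 1) + (n + 1))
        + (n + 1) + 1 + n * n := by
  have ha : eval (fun _ => (1 : ℂ)) (perPoly (Fin n) ℂ) ≠ 0 := by
    rw [eval_one_perPoly]; exact_mod_cast n.factorial_ne_zero
  have hN : (perPoly (Fin n) ℂ).totalDegree ≤ n :=
    perPoly_isHomogeneous.totalDegree_le.trans (by rw [Fintype.card_fin])
  have h := complexity_le_of_pow (perPoly (Fin n) ℂ) (fun _ => (1 : ℂ)) ha hN hk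
  simpa only [Fintype.card_prod, Fintype.card_fin] using h

/-- **ON-PATH LEMMA `S → PowerShadow k`** (`k ≥ 1`): a p-bounded sequence of affine representations of `per_n ^ k`
gives `L(per_n ^ k) ≤ 8(m_n+1)^7 + m_n²(2n²+1)` p-bounded, hence (root extraction) `L(per_n)` p-bounded, i.e.
`PER` is p-computable, i.e. `VP_ℂ = VNP_ℂ` (`isPComputable_perPoly_complex_iff`).
[cite: Burgisser2000, Rem. 2.11, Thm. 2.10, Thm. 2.21] -/
theorem powerShadow_of_summit (k : ℕ) (hk : 1 ≤ k) (hS : _root_.ValiantsHypothesis) : PowerShadow k := by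
  intro m r Λ B hyp hPB
  have hm : IsPBounded m :=
    IsPBounded.of_eventually_le 0 hPB fun n _ => Nat.le_mul_of_pos_right _ Nat.one_le_two_pow
  -- the polynomial bookkeeping functions
  have hn1 : IsPBounded (fun n : ℕ => n + 1) := IsPBounded.add_holds IsPBounded.id (IsPBounded.const 1)
  have hn2 : IsPBounded (fun n : ℕ => n + 2) := IsPBounded.add_holds IsPBounded.id (IsPBounded.const 2)
  have hnn : IsPBounded (fun n : ℕ => n * n) := IsPBounded.mul_holds IsPBounded.id IsPBounded.id
  have hE : IsPBounded (fun n => 8 * (m n + 1) ^ 7 + m n ^ 2 * (2 * (n * n) + 1)) :=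
    IsPBounded.add_holds
      (IsPBounded.mul_holds (IsPBounded.const 8) (IsPBounded.pow_holds (IsPBounded.add_holds hm (IsPBounded.const 1)) 7))
      (IsPBounded.mul_holds (IsPBounded.pow_holds hm 2)
        (IsPBounded.add_holds (IsPBounded.mul_holds (IsPBounded.const 2) hnn) (IsPBounded.const 1)))
  have hX : IsPBounded (fun n => 8 * (m n + 1) ^ 7 + m n ^ 2 * (2 * (n * n) + 1) + n * n + 3) :=
    IsPBounded.add_holds (IsPBounded.add_holds hE hnn) (IsPBounded.const 3)
  have h1 : IsPBounded (fun n => (n + 1) * (8 * (m n + 1) ^ 7 + m n ^ 2 * (2 * (n * n) + 1) + n * n + 3)) :=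
    IsPBounded.mul_holds hn1 hX
  have h2 : IsPBounded (fun n => (n + 1) * (8 * (m n + 1) ^ 7 + m n ^ 2 * (2 * (n * n) + 1) + n * n + 3) + 1) :=
    IsPBounded.add_holds h1 (IsPBounded.const 1)
  have h3 : IsPBounded (fun n => (n + 1) *
      ((n + 1) * (8 * (m n + 1) ^ 7 + m n ^ 2 * (2 * (n * n) + 1) + n * n + 3) + 1)) :=
    IsPBounded.mul_holds hn1 h2
  have h4 : IsPBounded (fun n => (n + 1) *
      ((n + 1) * (8 * (m n + 1) ^ 7 + m n ^ 2 * (2 * (n * n) + 1) + n * n + 3) + 1) + (n + 1)) :=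
    IsPBounded.add_holds h3 hn1
  have h5 : IsPBounded (fun n => (n + 2) ^ 2 * ((n + 1) *
      ((n + 1) * (8 * (m n + 1) ^ 7 + m n ^ 2 * (2 * (n * n) + 1) + n * n + 3) + 1) + (n + 1))) :=
    IsPBounded.mul_holds (IsPBounded.pow_holds hn2 2) h4
  have hF : IsPBounded (fun n => (n + 2) ^ 2 * ((n + 1) *
      ((n + 1) * (8 * (m n + 1) ^ 7 + m n ^ 2 * (2 * (n * n) + 1) + n * n + 3) + 1) + (n + 1))
      + (n + 1) + 1 + n * n) :=
    IsPBounded.add_holds (IsPBounded.add_holds (IsPBounded.add_holds h5 hn1) (IsPBounded.const 1)) hnn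
  have hL : IsPComputable (fun n => perPoly (Fin n) ℂ) := by
    refine IsPBounded.of_eventually_le 3 hF fun n hn => ?_
    have hrep := (hyp n hn).2
    have hdet : (B n).det = perPoly (Fin n) ℂ ^ k := hrep.1.2
    have hEk : complexity (perPoly (Fin n) ℂ ^ k) ≤ 8 * (m n + 1) ^ 7 + m n ^ 2 * (2 * (n * n) + 1) := by
      rw [← hdet]
      refine (complexity_det_le (B n)).trans ?_
      have h8 := complexity_detPoly_le ℂ (m n)
      have hs := sum_complexity_le_of_affine hrep.1.1
      omega
    show complexity (perPoly (Fin n) ℂ) ≤ _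
    refine (complexity_perPoly_le_of_pow n k hk).trans ?_
    gcongr
  exact hS (isPComputable_perPoly_complex_iff.1 hL)

/-- **`S → SquareShadow`** (the rung's on-path lemma, by name; `aesop` safe rule for the tribunal kernel).
[cite: Burgisser2000, Thm. 2.21] -/
@[aesop safe apply]
theorem squareShadow_of_summit (hS : _root_.ValiantsHypothesis) : SquareShadow :=
  powerShadow_of_summit 2 (by norm_num) hS

/-- Same, under the F-protocol name `<Rung>_of_ValiantsHypothesis`. [cite: Burgisser2000, Thm. 2.21] -/
@[aesop safe apply]
theorem SquareShadow_of_ValiantsHypothesis : _root_.ValiantsHypothesis → SquareShadow :=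
  squareShadow_of_summit

/-! ## §4 How the rung relaxes the open crux `OrbitDimensionBound` -/

/-- **`OrbitPowerBound k`** — the symmetrisation target RELAXED by the rung: eventually in `n`, every affine
determinantal representation `A` of `per_n` of size `m` can be replaced by a `T_Λ`-equivariant (exact constant
lifts) affine representation `B` of SOME POWER `per_n ^ j`, `1 ≤ j ≤ k`, of size `≤ k · m`, for some admissible
`Λ` of rank `r ≤ ⌊n/2⌋` (the host crux's own budget).  Implied by `OrbitDimensionBound` (`j = 1`,
`orbitPowerBound_of_orbitDimensionBound`), not conversely: symmetrising into a power (e.g. `diag`-type or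
matrix-factorisation-type representations of `per_n ^ 2`) is extra freedom that the rung pays for with the loss
`k`.  Like the host crux it is an `∃ B`-statement, so the in-place refutations of
`Cruxes/OrbitDimensionBound/Disproof.lean` §4 do not touch it. [cite: LandsbergRessayre2017, Question 2.2, §6] -/
def OrbitPowerBound (k : ℕ) : Prop :=
  ∃ n₀ : ℕ, ∀ n : ℕ, n₀ ≤ n → ∀ (m : ℕ) (A : Matrix (Fin m) (Fin m) (MvPolynomial (Fin n × Fin n) ℂ)),
    IsAffineDetRepr (perPoly (Fin n) ℂ) A →
    ∃ (j m' : ℕ) (B : Matrix (Fin m') (Fin m') (MvPolynomial (Fin n × Fin n) ℂ)) (r : ℕ)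
      (Λ : Fin r → (Fin n ⊕ Fin n) → ℤ),
      1 ≤ j ∧ j ≤ k ∧ m' ≤ k * m ∧ r ≤ n / 2 ∧ Admissible n r Λ ∧
      IsEquivariantDetRepr (Subgroup.closure (torusGen n r Λ)) (perPoly (Fin n) ℂ ^ j) B

/-- The host crux implies the relaxed one (`j = 1`, same matrix). [cite: LandsbergRessayre2017, Question 2.2] -/
theorem orbitPowerBound_of_orbitDimensionBound {k : ℕ} (hk : 1 ≤ k)
    (h : Summit.ValiantsHypothesis.ValiantsHypothesis.Theses.FreeSubtorus.OrbitDimensionBound) :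
    OrbitPowerBound k := by
  refine ⟨3, fun n hn m A hA => ?_⟩
  obtain ⟨B, r, Λ, hr, hΛ, hB⟩ := h n hn m A hA
  refine ⟨1, m, B, r, Λ, le_rfl, hk, ?_, hr, hΛ, ?_⟩
  · calc m = 1 * m := (one_mul m).symm
      _ ≤ k * m := Nat.mul_le_mul_right _ hk
  · simpa only [pow_one, torusGen] using hB

/-- **Eventual middle bound with linear loss ⇒ VH**: if `C(n, ⌊n/2⌋) ≤ n · dc(per_n) · 2^{⌊n/2⌋}` for all large
`n` then `VP_ℂ ≠ VNP_ℂ` (arithmetic `(9/8)^n ≤ dc(per_n)` for `n ≥ 40`, then `expDcGlue_proof`).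
[cite: Burgisser2000, Thm. 2.10, Rem. 2.11] -/
theorem vh_of_eventual_linear_loss (n₀ : ℕ)
    (hstep : ∀ n : ℕ, n₀ ≤ n →
      Nat.choose n (n / 2) ≤ n * (determinantalComplexity (perPoly (Fin n) ℂ) * 2 ^ (n / 2))) :
    _root_.ValiantsHypothesis := by
  apply Summit.ValiantsHypothesis.Theorems.expDcGlue_proof
  refine ⟨9 / 8, by norm_num, max n₀ 40, fun n hn => ?_⟩
  have hn₀ : n₀ ≤ n := le_trans (le_max_left _ _) hn
  have h40 : 40 ≤ n := le_trans (le_max_right _ _) hn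
  have hs := hstep n hn₀
  have hA := nine_pow_bound' n h40
  have hB : 2 ^ n ≤ (n + 1) * Nat.choose n (n / 2) := two_pow_le_succ_mul_choose_middle n
  set D : ℕ := determinantalComplexity (perPoly (Fin n) ℂ) with hD
  have hsR : (Nat.choose n (n / 2) : ℝ) ≤ (n : ℝ) * ((D : ℝ) * (2 : ℝ) ^ (n / 2)) := by exact_mod_cast hs
  have hAR : (9 : ℝ) ^ n * (2 : ℝ) ^ (n / 2) * (((n : ℝ) + 1) * (n : ℝ)) ≤ (16 : ℝ) ^ n := by exact_mod_cast hA
  have hBR : (2 : ℝ) ^ n ≤ ((n : ℝ) + 1) * (Nat.choose n (n / 2) : ℝ) := by exact_mod_cast hB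
  have hnpos : (0 : ℝ) < (n : ℝ) := by exact_mod_cast (show 0 < n by omega)
  have hposP : (0 : ℝ) < (8 : ℝ) ^ n * (2 : ℝ) ^ (n / 2) * (((n : ℝ) + 1) * (n : ℝ)) := by positivity
  have h8 : (0 : ℝ) ≤ (8 : ℝ) ^ n := by positivity
  have hn1 : (0 : ℝ) ≤ (n : ℝ) + 1 := by positivity
  have key : (9 / 8 : ℝ) ^ n * ((8 : ℝ) ^ n * (2 : ℝ) ^ (n / 2) * (((n : ℝ) + 1) * (n : ℝ))) ≤
      (D : ℝ) * ((8 : ℝ) ^ n * (2 : ℝ) ^ (n / 2) * (((n : ℝ) + 1) * (n : ℝ))) := by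
    have e1 : (9 / 8 : ℝ) ^ n * ((8 : ℝ) ^ n * (2 : ℝ) ^ (n / 2) * (((n : ℝ) + 1) * (n : ℝ))) =
        (9 : ℝ) ^ n * (2 : ℝ) ^ (n / 2) * (((n : ℝ) + 1) * (n : ℝ)) := by
      rw [div_pow]; field_simp
    have e2 : (16 : ℝ) ^ n = (8 : ℝ) ^ n * (2 : ℝ) ^ n := by rw [← mul_pow]; norm_num
    rw [e1]
    calc (9 : ℝ) ^ n * (2 : ℝ) ^ (n / 2) * (((n : ℝ) + 1) * (n : ℝ)) ≤ (16 : ℝ) ^ n := hAR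
      _ = (8 : ℝ) ^ n * (2 : ℝ) ^ n := e2
      _ ≤ (8 : ℝ) ^ n * (((n : ℝ) + 1) * (Nat.choose n (n / 2) : ℝ)) := mul_le_mul_of_nonneg_left hBR h8
      _ ≤ (8 : ℝ) ^ n * (((n : ℝ) + 1) * ((n : ℝ) * ((D : ℝ) * (2 : ℝ) ^ (n / 2)))) := by
          apply mul_le_mul_of_nonneg_left _ h8
          exact mul_le_mul_of_nonneg_left hsR hn1
      _ = (D : ℝ) * ((8 : ℝ) ^ n * (2 : ℝ) ^ (n / 2) * (((n : ℝ) + 1) * (n : ℝ))) := by ring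
  exact le_of_mul_le_mul_right key hposP

/-- **Relaxed target + numeric rung ⇒ VH**: for large `n`, an optimal expression `A` of `per_n`
(`hasDetRepr_determinantalComplexity_holds`) is re-realised equivariantly as a representation of `per_n ^ j`
(`j ∈ {1, 2}`) of size `≤ 2 dc(per_n)` with `r ≤ ⌊n/2⌋`; the floor (`j = 1`) or the rung (`j = 2`) gives
`C(n,⌊n/2⌋) ≤ j · m' · 2^r ≤ 4 · dc(per_n) · 2^{⌊n/2⌋} ≤ n · dc(per_n) · 2^{⌊n/2⌋}`; `vh_of_eventual_linear_loss`
concludes. [cite: LandsbergRessayre2017, Question 2.2] [cite: Burgisser2000, Thm. 2.10] -/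
theorem closes_square (h₁ : OrbitPowerBound 2) (h₂ : SquareCovering) : _root_.ValiantsHypothesis := by
  obtain ⟨n₀, h₁⟩ := h₁
  refine vh_of_eventual_linear_loss (max n₀ 4) fun n hn => ?_
  have hn₀ : n₀ ≤ n := le_trans (le_max_left _ _) hn
  have hn4 : 4 ≤ n := le_trans (le_max_right _ _) hn
  have hn3 : 3 ≤ n := by omega
  obtain ⟨A, hA⟩ := hasDetRepr_determinantalComplexity_holds (perPoly (Fin n) ℂ)
  obtain ⟨j, m', B, r, Λ, hj1, hj2, hm', hr, hΛ, hB⟩ := h₁ n hn₀ _ A hA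
  set D : ℕ := determinantalComplexity (perPoly (Fin n) ℂ) with hD
  have hcov : n.choose (n / 2) ≤ j * (m' * 2 ^ r) := by
    interval_cases j
    · exact powerCovering_one n hn3 m' r Λ B hΛ hB
    · exact h₂ n hn3 m' r Λ B hΛ hB
  have h2r : 2 ^ r ≤ 2 ^ (n / 2) := Nat.pow_le_pow_right (by norm_num) hr
  calc n.choose (n / 2) ≤ j * (m' * 2 ^ r) := hcov
    _ ≤ 2 * (2 * D * 2 ^ (n / 2)) := by gcongr
    _ = 4 * (D * 2 ^ (n / 2)) := by ring
    _ ≤ n * (D * 2 ^ (n / 2)) := Nat.mul_le_mul_right _ hn4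

/-- The rung also closes the host route with its ORIGINAL crux (`OrbitDimensionBound → SquareCovering → VH`).
[cite: LandsbergRessayre2017, Question 2.2] -/
theorem closes_of_orbitDimensionBound
    (h₁ : Summit.ValiantsHypothesis.ValiantsHypothesis.Theses.FreeSubtorus.OrbitDimensionBound)
    (h₂ : SquareCovering) : _root_.ValiantsHypothesis :=
  closes_square (orbitPowerBound_of_orbitDimensionBound (by norm_num) h₁) h₂

end

end Summit.ValiantsHypothesis.ValiantsHypothesis.Cruxes.OrbitDimensionBound.Power
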